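import Mathlib
import HarnessLib
import Summits.HubbardSuperconductivity.HubbardSuperconductivity.Theorems.KLProgrammeKLRegimeTwoVolumeSrcStepCovZeroAlphaW
import Summits.HubbardSuperconductivity.HubbardSuperconductivity.Theorems.KLProgrammeKLRegimeTwoVolumeTowerStepCovSliceTwoFrame

/-!
# Route `KLProgramme` — K3 engine / VL support: the THICK slice `(Λ_J, Λ_{J′}]` (`1 ≤ J′ ≤ J`) sandwiched by the scale-`0` fat multipliers,
# `S(F̃_0)ᵀ·C^K_{(Λ_J,Λ_{J′}]}·S(F̃_0)`, IS A SUBMATRIX OF THE GRID-SANDWICHED DIFFERENCE `S_{4M}ᵀ(C^K_{>Λ_J} − C^K_{>Λ_{J′}})S_{4M}`; hence its Gram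
# constant and its `klScaleWt`-weighted rows / columns for EVERY admissible frame, NO window (cell gate-hubbard-kl, seat p3 g21)

Generalisation of `…TwoVolumeSrcStepCovZeroGridRows/AlphaW` (the single slice `(Λ₂, Λ₁]` = `klStepCov … K 0`) to the covariance of a PARTIAL BLOCK from
`J₁ = 1`: the block covariance `C^K_{(Λ_J, Λ_1]}` lives in the plateau of `F_0`, whose fat partner `F̃_0` is `≡ 1` on `√(k₀² + e_K²) ≤ e₀`
(`fatZero_pullback_sliceCT_eq_pullback_one`, any `0 < Λ ≤ Λ′ ≤ e₀`), so the sandwich is the pull-back by the constant-one family, i.e. the grid kernel at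
the even grid times (`sectorSubMatrix_one_eq_hubbardGridSub`).  This is the data the (ℓ) block-`0` partial blocks (E1, «(ℓ)-BLOCK0»: levels `1 ≤ j+1 ≤ d`
from `𝒱_1@F_0` by partial sectorised blocks from `J₁ = 1`, HE1-GRANULARITY §2) and the VL source tower's block `0` read at `F̃_0`:

* `sliceCT_fatZero_apply_eq_grid` — the identity (any cutoffs `0 < Λ ≤ Λ′ ≤ e₀`; from p3 g19's `fatZero_pullback_sliceCT_eq_pullback_one` and
  `sectorSubMatrix_one_eq_hubbardGridSub`);
* **`rowColSumWt_sliceCT_fatZero_of_gridRows`** — rows / cols (any rate `r`) `≤ 2·(α_Λ + α_{Λ′})` from the `gridLabelWt` rows and columns of the two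
  grid-sandwiched UV covariances;
* **`exists_alphaWt_sliceCT_fatZero (J′ ≤ J)`** — for every `FrameOK` frame, from `rowSum_/colSum_scaleCutoff_gridLabelWt_le_X5` at `Λ_J` and `Λ_{J′}`,
  ONE absolute `D = D(J, J′)`: rows / cols `≤ (M/β)·D·(1+ΣGfr)⁴` under `R.WF`, `|U| ≤ 1`, `(N_sc+1)U² ≤ 1/2`, the thresholds;
* **`isGramBoundedR_sliceCT_fatZero_uniform (J′ ≤ J)`** — the replica-Gram constant `√(8(Λ_{J′}/π + 3/128)(1793Λ_{J′} + 704)/Λ_J)`, `β`-free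
  (`KLRegimeSplit.isGramBoundedR_sliceCT_of_frameOK`, `norm_bgmFatMultiplier_le_one`).

Everything is proved; no definitions, no sorry.  Nothing asserts any stub, (ℓ), VL, K3 or superconductivity.
[cite: BenfattoGiulianiMastropietro2006, §2.7 (2.66)–(2.67), §2.8 (2.80)–(2.81), §3 (3.3)]
-/

noncomputable section

namespace Summit.HubbardSuperconductivity.HubbardSuperconductivity.Theorems.TwoVolumeSource

set_option linter.dupNamespace false -- summit = problem name (single-conjunct summit), D-0017

open Finset Literature.MathematicalPhysics.QuantumLattice Literature.Probability.LatticeModels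
open Summit.HubbardSuperconductivity.HubbardSuperconductivity.Theorems.KLRegimeSplit
open Summit.HubbardSuperconductivity.HubbardSuperconductivity.Theorems.KLProgrammeLegKernels
open Summit.HubbardSuperconductivity.HubbardSuperconductivity.Theorems.EngineV8
open Summit.HubbardSuperconductivity.HubbardSuperconductivity.Theorems.ScaleZeroDecay
open Summit.HubbardSuperconductivity.HubbardSuperconductivity.Theorems.TorusFourierL2

variable {V M : ℕ} [NeZero V] [NeZero M]

/-! ## §1 The identity -/

/-- **Entrywise, the scale-`0` fat sandwich of the slice `(Λ, Λ′]` IS the grid-sandwiched difference `S_{4M}ᵀ(C^K_{>Λ} − C^K_{>Λ′})S_{4M}` at the even grid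
times** (`0 < Λ ≤ Λ′ ≤ e₀`). [cite: BenfattoGiulianiMastropietro2006, §2.7 (2.66)–(2.67)] -/
theorem sliceCT_fatZero_apply_eq_grid {β : ℝ} (hβ : β ≠ 0) (μ : ℝ) (K : TrigPolyC4v) {Λ Λ' : ℝ} (hΛ : 0 < Λ) (hΛΛ' : Λ ≤ Λ') (hΛ'e : Λ' ≤ klE0)
    (Y Y' : SpaceTimeIdx V M × SectorLeg (sectorCount 0)) :
    ((sectorSubMatrix V M β (bgmFatMultiplier V M klE0 β (nambuXiCT V μ K) 0)).transpose * hubbardCovSliceCT V M β μ 0 K Λ Λ' *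
        sectorSubMatrix V M β (bgmFatMultiplier V M klE0 β (nambuXiCT V μ K) 0)) Y Y' =
      ((hubbardGridSub V M β (2 * (2 * M))).transpose * hubbardCovAboveCT V M β μ 0 K Λ * hubbardGridSub V M β (2 * (2 * M)))
          (((⟨2 * (Y.1.1 : ℕ), two_mul_imagTimeIdx_lt Y.1.1⟩, Y.1.2), Y.2.1.2), Y.2.2)
          (((⟨2 * (Y'.1.1 : ℕ), two_mul_imagTimeIdx_lt Y'.1.1⟩, Y'.1.2), Y'.2.1.2), Y'.2.2) -
        ((hubbardGridSub V M β (2 * (2 * M))).transpose * hubbardCovAboveCT V M β μ 0 K Λ' * hubbardGridSub V M β (2 * (2 * M)))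
          (((⟨2 * (Y.1.1 : ℕ), two_mul_imagTimeIdx_lt Y.1.1⟩, Y.1.2), Y.2.1.2), Y.2.2)
          (((⟨2 * (Y'.1.1 : ℕ), two_mul_imagTimeIdx_lt Y'.1.1⟩, Y'.1.2), Y'.2.1.2), Y'.2.2) := by
  rw [fatZero_pullback_sliceCT_eq_pullback_one hβ μ K hΛ hΛΛ' hΛ'e, hubbardCovSliceCT, Matrix.mul_sub, Matrix.sub_mul, Matrix.sub_apply]
  obtain ⟨y, ℓ⟩ := Y
  obtain ⟨y', ℓ'⟩ := Y'
  simp only [Matrix.mul_apply, Matrix.transpose_apply, sectorSubMatrix_one_eq_hubbardGridSub]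

/-! ## §2 Weighted rows and columns from the grid rows at the two cutoffs -/

/-- **Weighted rows and columns of the scale-`0` fat sandwich of `(Λ, Λ′]` from the `gridLabelWt`-weighted rows and columns of the grid-sandwiched UV
covariances at `Λ` and `Λ′`** (any rate `r`; `0 < Λ ≤ Λ′ ≤ e₀`): `≤ 2·(α_Λ + α_{Λ′})`. [cite: BenfattoGiulianiMastropietro2006, §2.8 (2.81), §3 (3.3)] -/
theorem rowColSumWt_sliceCT_fatZero_of_gridRows {β : ℝ} (hβ : 0 < β) (μ : ℝ) (K : TrigPolyC4v) {Λ Λ' : ℝ} (hΛ : 0 < Λ) (hΛΛ' : Λ ≤ Λ')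
    (hΛ'e : Λ' ≤ klE0) (r : ℕ) {α₂ α₁ : ℝ}
    (hrow₂ : ∀ X, ∑ Y, ‖((hubbardGridSub V M β (2 * (2 * M))).transpose * hubbardCovAboveCT V M β μ 0 K Λ *
        hubbardGridSub V M β (2 * (2 * M))) X Y‖ * gridLabelWt V (2 * (2 * M)) β {gridLegPos X, gridLegPos Y} ≤ α₂)
    (hcol₂ : ∀ Y, ∑ X, ‖((hubbardGridSub V M β (2 * (2 * M))).transpose * hubbardCovAboveCT V M β μ 0 K Λ *
        hubbardGridSub V M β (2 * (2 * M))) X Y‖ * gridLabelWt V (2 * (2 * M)) β {gridLegPos X, gridLegPos Y} ≤ α₂)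
    (hrow₁ : ∀ X, ∑ Y, ‖((hubbardGridSub V M β (2 * (2 * M))).transpose * hubbardCovAboveCT V M β μ 0 K Λ' *
        hubbardGridSub V M β (2 * (2 * M))) X Y‖ * gridLabelWt V (2 * (2 * M)) β {gridLegPos X, gridLegPos Y} ≤ α₁)
    (hcol₁ : ∀ Y, ∑ X, ‖((hubbardGridSub V M β (2 * (2 * M))).transpose * hubbardCovAboveCT V M β μ 0 K Λ' *
        hubbardGridSub V M β (2 * (2 * M))) X Y‖ * gridLabelWt V (2 * (2 * M)) β {gridLegPos X, gridLegPos Y} ≤ α₁) :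
    (∀ Y, ∑ Y', ‖((sectorSubMatrix V M β (bgmFatMultiplier V M klE0 β (nambuXiCT V μ K) 0)).transpose * hubbardCovSliceCT V M β μ 0 K Λ Λ' *
        sectorSubMatrix V M β (bgmFatMultiplier V M klE0 β (nambuXiCT V μ K) 0)) Y Y'‖ *
        klScaleWt V M β r {latticeLegPos (2 * (2 * M)) Y, latticeLegPos (2 * (2 * M)) Y'} ≤ 2 * (α₂ + α₁)) ∧
    (∀ Y', ∑ Y, ‖((sectorSubMatrix V M β (bgmFatMultiplier V M klE0 β (nambuXiCT V μ K) 0)).transpose * hubbardCovSliceCT V M β μ 0 K Λ Λ' *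
        sectorSubMatrix V M β (bgmFatMultiplier V M klE0 β (nambuXiCT V μ K) 0)) Y Y'‖ *
        klScaleWt V M β r {latticeLegPos (2 * (2 * M)) Y, latticeLegPos (2 * (2 * M)) Y'} ≤ 2 * (α₂ + α₁)) := by
  classical
  set ι : SpaceTimeIdx V M × SectorLeg (sectorCount 0) → GridLeg (GridPoint V (2 * (2 * M))) :=
    fun Y => (((⟨2 * (Y.1.1 : ℕ), two_mul_imagTimeIdx_lt Y.1.1⟩, Y.1.2), Y.2.1.2), Y.2.2) with hι
  set G₂ := (hubbardGridSub V M β (2 * (2 * M))).transpose * hubbardCovAboveCT V M β μ 0 K Λ * hubbardGridSub V M β (2 * (2 * M)) with hG₂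
  set G₁ := (hubbardGridSub V M β (2 * (2 * M))).transpose * hubbardCovAboveCT V M β μ 0 K Λ' * hubbardGridSub V M β (2 * (2 * M)) with hG₁
  set C := (sectorSubMatrix V M β (bgmFatMultiplier V M klE0 β (nambuXiCT V μ K) 0)).transpose * hubbardCovSliceCT V M β μ 0 K Λ Λ' *
    sectorSubMatrix V M β (bgmFatMultiplier V M klE0 β (nambuXiCT V μ K) 0) with hC
  have hpos : ∀ Y : SpaceTimeIdx V M × SectorLeg (sectorCount 0), gridLegPos (ι Y) = latticeLegPos (2 * (2 * M)) Y := fun Y => rfl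
  have hentry : ∀ Y Y', C Y Y' = G₂ (ι Y) (ι Y') - G₁ (ι Y) (ι Y') := fun Y Y' =>
    sliceCT_fatZero_apply_eq_grid hβ.ne' μ K hΛ hΛΛ' hΛ'e Y Y'
  have hterm : ∀ Y Y', ‖C Y Y'‖ * klScaleWt V M β r {latticeLegPos (2 * (2 * M)) Y, latticeLegPos (2 * (2 * M)) Y'} ≤
      (‖G₂ (ι Y) (ι Y')‖ + ‖G₁ (ι Y) (ι Y')‖) * gridLabelWt V (2 * (2 * M)) β {gridLegPos (ι Y), gridLegPos (ι Y')} := by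
    intro Y Y'
    rw [hentry, hpos, hpos]
    exact mul_le_mul (norm_sub_le _ _) (klScaleWt_le_gridLabelWt β r _) (zero_le_one.trans (one_le_klScaleWt V M β r _)) (by positivity)
  have hfib : ∀ g, (univ.filter fun Y : SpaceTimeIdx V M × SectorLeg (sectorCount 0) => ι Y = g).card ≤ 2 :=
    fun g => card_fibre_latticeToGrid_le_two g
  constructor
  · intro Y
    calc ∑ Y', ‖C Y Y'‖ * klScaleWt V M β r {latticeLegPos (2 * (2 * M)) Y, latticeLegPos (2 * (2 * M)) Y'}
        ≤ ∑ Y', (fun g => (‖G₂ (ι Y) g‖ + ‖G₁ (ι Y) g‖) * gridLabelWt V (2 * (2 * M)) β {gridLegPos (ι Y), gridLegPos g}) (ι Y') :=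
          sum_le_sum fun Y' _ => hterm Y Y'
      _ ≤ 2 * ∑ g, (‖G₂ (ι Y) g‖ + ‖G₁ (ι Y) g‖) * gridLabelWt V (2 * (2 * M)) β {gridLegPos (ι Y), gridLegPos g} :=
          sum_comp_le_two_mul_sum ι (fun g => (‖G₂ (ι Y) g‖ + ‖G₁ (ι Y) g‖) * gridLabelWt V (2 * (2 * M)) β {gridLegPos (ι Y), gridLegPos g})
            (fun g => mul_nonneg (by positivity) (zero_le_one.trans (one_le_gridLabelWt _ _ _ _))) hfib
      _ ≤ 2 * (α₂ + α₁) := by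
          have h := add_le_add (hrow₂ (ι Y)) (hrow₁ (ι Y))
          rw [← sum_add_distrib] at h
          refine mul_le_mul_of_nonneg_left (le_trans (le_of_eq (sum_congr rfl fun g _ => by ring)) h) (by norm_num)
  · intro Y'
    calc ∑ Y, ‖C Y Y'‖ * klScaleWt V M β r {latticeLegPos (2 * (2 * M)) Y, latticeLegPos (2 * (2 * M)) Y'}
        ≤ ∑ Y, (fun g => (‖G₂ g (ι Y')‖ + ‖G₁ g (ι Y')‖) * gridLabelWt V (2 * (2 * M)) β {gridLegPos g, gridLegPos (ι Y')}) (ι Y) :=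
          sum_le_sum fun Y _ => hterm Y Y'
      _ ≤ 2 * ∑ g, (‖G₂ g (ι Y')‖ + ‖G₁ g (ι Y')‖) * gridLabelWt V (2 * (2 * M)) β {gridLegPos g, gridLegPos (ι Y')} :=
          sum_comp_le_two_mul_sum ι (fun g => (‖G₂ g (ι Y')‖ + ‖G₁ g (ι Y')‖) * gridLabelWt V (2 * (2 * M)) β {gridLegPos g, gridLegPos (ι Y')})
            (fun g => mul_nonneg (by positivity) (zero_le_one.trans (one_le_gridLabelWt _ _ _ _))) hfib
      _ ≤ 2 * (α₂ + α₁) := by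
          have h := add_le_add (hcol₂ (ι Y')) (hcol₁ (ι Y'))
          rw [← sum_add_distrib] at h
          refine mul_le_mul_of_nonneg_left (le_trans (le_of_eq (sum_congr rfl fun g _ => by ring)) h) (by norm_num)

/-! ## §3 For every admissible frame: the thick slice `(Λ_J, Λ_{J′}]`, `J′ ≤ J` -/

omit [NeZero V] [NeZero M] in
/-- `0 < Λ_J ≤ Λ_{J′} ≤ e₀` for `J′ ≤ J`. [folklore] -/
theorem klScale_thick_facts {J J' : ℕ} (hJ : J' ≤ J) : 0 < klScale klE0 J ∧ klScale klE0 J ≤ klScale klE0 J' ∧ klScale klE0 J' ≤ klE0 := by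
  have he : (0 : ℝ) < klE0 := by norm_num [klE0]
  refine ⟨klth_klScale_pos J, klScale_le_klScale he.le hJ, ?_⟩
  unfold klScale
  exact mul_le_of_le_one_right he.le (inv_le_one_of_one_le₀ (one_le_pow₀ (by norm_num)))

/-- **Weighted rows and columns of `S(F̃_0)ᵀC^K_{(Λ_J,Λ_{J′}]}S(F̃_0)` for every admissible frame, ONE absolute constant `D = D(J, J′)`** (`J′ ≤ J`; any rate
`r`): `≤ (M/β)·D·(1+ΣGfr)⁴` under `R.WF`, `|U| ≤ 1`, `(N_sc+1)U² ≤ 1/2`, `FrameOK R U N_sc μ K`, `klBetaMin ≤ β`, `klEngL₃ β U ≤ V`, `klEngM₃ β U V ≤ M` —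
the `α = Cb·(M/β)/Λ_J` input of a partial block `(1 → J)` read at `F̃_0` (E1's (ℓ) block `0`; the VL source tower's block `0`).
[cite: BenfattoGiulianiMastropietro2006, §2.8 (2.81), §3 (3.3)] -/
theorem exists_alphaWt_sliceCT_fatZero {J J' : ℕ} (hJ : J' ≤ J) : ∃ D : ℝ, 1 ≤ D ∧
    ∀ (R : RenConsts) (U μ β : ℝ) (Nsc : ℕ) (K : TrigPolyC4v), R.WF → |U| ≤ 1 → (((Nsc : ℕ) : ℝ) + 1) * U ^ 2 ≤ 1 / 2 →
      FrameOK R U Nsc μ K → klBetaMin ≤ β → ∀ (V M : ℕ) [NeZero V] [NeZero M], klEngL₃ β U ≤ V → klEngM₃ β U V ≤ M → ∀ r : ℕ,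
      (∀ Y, ∑ Y', ‖((sectorSubMatrix V M β (bgmFatMultiplier V M klE0 β (nambuXiCT V μ K) 0)).transpose *
          hubbardCovSliceCT V M β μ 0 K (klScale klE0 J) (klScale klE0 J') * sectorSubMatrix V M β (bgmFatMultiplier V M klE0 β (nambuXiCT V μ K) 0)) Y Y'‖ *
          klScaleWt V M β r {latticeLegPos (2 * (2 * M)) Y, latticeLegPos (2 * (2 * M)) Y'} ≤ (M : ℝ) / β * (D * (1 + R.Gfr 0 + R.Gfr 1 + R.Gfr 2 + R.Gfr 3) ^ 4)) ∧
      (∀ Y', ∑ Y, ‖((sectorSubMatrix V M β (bgmFatMultiplier V M klE0 β (nambuXiCT V μ K) 0)).transpose *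
          hubbardCovSliceCT V M β μ 0 K (klScale klE0 J) (klScale klE0 J') * sectorSubMatrix V M β (bgmFatMultiplier V M klE0 β (nambuXiCT V μ K) 0)) Y Y'‖ *
          klScaleWt V M β r {latticeLegPos (2 * (2 * M)) Y, latticeLegPos (2 * (2 * M)) Y'} ≤ (M : ℝ) / β * (D * (1 + R.Gfr 0 + R.Gfr 1 + R.Gfr 2 + R.Gfr 3) ^ 4)) := by
  obtain ⟨D₂, hD₂, h₂⟩ := exists_abarCutoff_le J
  obtain ⟨D₁, hD₁, h₁⟩ := exists_abarCutoff_le J'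
  obtain ⟨hΛ, hΛΛ', hΛ'e⟩ := klScale_thick_facts hJ
  refine ⟨8 * (D₂ + D₁), by linarith, ?_⟩
  intro R U μ β Nsc K hR hU1 hN hK hβ V M _ _ hL hM r
  haveI : NeZero (2 * (2 * M)) := ⟨by have := NeZero.ne M; omega⟩
  have hβ0 : 0 < β := beta_pos_of_klBetaMin_le hβ
  have hM0 : (0 : ℝ) < M := Nat.cast_pos.2 (Nat.pos_of_ne_zero (NeZero.ne M))
  have hN4 : (((2 * (2 * M) : ℕ) : ℝ)) = 4 * M := by push_cast; ring
  obtain ⟨hrow, hcol⟩ := rowColSumWt_sliceCT_fatZero_of_gridRows (V := V) (M := M) hβ0 μ K hΛ hΛΛ' hΛ'e r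
    (rowSum_scaleCutoff_gridLabelWt_le_X5 (L := V) (M := M) J hK hR hU1 hβ hL hM) (colSum_scaleCutoff_gridLabelWt_le_X5 (L := V) (M := M) J hK hR hU1 hβ hL hM)
    (rowSum_scaleCutoff_gridLabelWt_le_X5 (L := V) (M := M) J' hK hR hU1 hβ hL hM) (colSum_scaleCutoff_gridLabelWt_le_X5 (L := V) (M := M) J' hK hR hU1 hβ hL hM)
  have hb₂ := h₂ R U Nsc hR hU1 hN
  have hb₁ := h₁ R U Nsc hR hU1 hN
  have hfac : 0 ≤ (((2 * (2 * M) : ℕ) : ℝ)) / β := by positivity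
  have hNc : (((2 * (2 * M) : ℕ) : ℝ)) / β = 4 * ((M : ℝ) / β) := by rw [hN4]; ring
  exact ⟨fun Y => stepCovZero_alpha_bookkeeping (hrow Y) hb₂ hb₁ hfac hNc, fun Y' => stepCovZero_alpha_bookkeeping (hcol Y') hb₂ hb₁ hfac hNc⟩

/-! ## §4 The replica-Gram constant of the thick slice, `β`-free -/

/-- **`S(F̃_0)ᵀC^K_{(Λ_J,Λ_{J′}]}S(F̃_0)` is replica-Gram-bounded with a `β`-free constant** for every admissible frame and `β ≥ klBetaMin` (`J′ ≤ J`):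
`κ = √(8(Λ_{J′}/π + 3/128)(1793Λ_{J′} + 704)/Λ_J)`. [cite: BenfattoGiulianiMastropietro2006, §2.8 (2.80)] -/
theorem isGramBoundedR_sliceCT_fatZero_uniform {R : RenConsts} {U : ℝ} {N : ℕ} {μ : ℝ} {K : TrigPolyC4v} (hK : FrameOK R U N μ K)
    {β : ℝ} (hβ : klBetaMin ≤ β) {J J' : ℕ} (hJ : J' ≤ J) :
    IsGramBoundedR ((sectorSubMatrix V M β (bgmFatMultiplier V M klE0 β (nambuXiCT V μ K) 0)).transpose *
        hubbardCovSliceCT V M β μ 0 K (klScale klE0 J) (klScale klE0 J') * sectorSubMatrix V M β (bgmFatMultiplier V M klE0 β (nambuXiCT V μ K) 0))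
      (Real.sqrt (8 * (klScale klE0 J' / Real.pi + 3 / 128) * (1793 * klScale klE0 J' + 704) / klScale klE0 J)) := by
  have hβ128 : (128 : ℝ) ≤ β := by simpa [klBetaMin] using hβ
  have hβ0 : 0 < β := by linarith
  obtain ⟨hΛ, hΛΛ', -⟩ := klScale_thick_facts hJ
  have hΛ' : 0 < klScale klE0 J' := klth_klScale_pos J'
  have hV : (1 : ℝ) ≤ V := by exact_mod_cast Nat.pos_of_ne_zero (NeZero.ne V)
  have hV0 : (0 : ℝ) < V := by linarith
  have h := isGramBoundedR_sliceCT_of_frameOK (L := V) (M := M) hK hβ0 hΛ hΛΛ' ((klScale_klE0_lt_tube J').le)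
    (bgmFatMultiplier V M klE0 β (nambuXiCT V μ K) 0) (fun ω k => norm_bgmFatMultiplier_le_one klE0 β (nambuXiCT V μ K) 0 ω k)
  refine IsGramBoundedR.mono h (Real.sqrt_nonneg _) (Real.sqrt_le_sqrt ?_)
  -- `‖(βV²)⁻¹‖²·(Λ′β/π+3)(1793Λ′V²+704V)·(2βV²/Λ) ≤ 8(Λ′/π+3/128)(1793Λ′+704)/Λ`
  have hn : ‖(((1 / (β * (V : ℝ) ^ 2) : ℝ) : ℂ))‖ ^ 2 = 1 / (β * (V : ℝ) ^ 2) ^ 2 := by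
    rw [Complex.norm_real, Real.norm_eq_abs, abs_of_pos (by positivity)]; ring
  rw [hn]
  have h1 : klScale klE0 J' * β / Real.pi + 3 ≤ (klScale klE0 J' / Real.pi + 3 / 128) * β := by
    have h3 : (3 : ℝ) ≤ 3 / 128 * β := by linarith
    have he : klScale klE0 J' * β / Real.pi = klScale klE0 J' / Real.pi * β := by ring
    rw [he, add_mul]; linarith
  have h2 : 1793 * klScale klE0 J' * (V : ℝ) ^ 2 + 704 * V ≤ (1793 * klScale klE0 J' + 704) * (V : ℝ) ^ 2 := by
    have : (704 : ℝ) * V ≤ 704 * (V : ℝ) ^ 2 := by nlinarith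
    nlinarith
  have hA : 0 ≤ klScale klE0 J' * β / Real.pi + 3 := by positivity
  have hB : 0 ≤ 1793 * klScale klE0 J' * (V : ℝ) ^ 2 + 704 * V := by positivity
  calc 1 / (β * (V : ℝ) ^ 2) ^ 2 * ((klScale klE0 J' * β / Real.pi + 3) * (1793 * klScale klE0 J' * (V : ℝ) ^ 2 + 704 * V) *
        (2 * (β * (V : ℝ) ^ 2) / klScale klE0 J))
      ≤ 1 / (β * (V : ℝ) ^ 2) ^ 2 * (((klScale klE0 J' / Real.pi + 3 / 128) * β) * ((1793 * klScale klE0 J' + 704) * (V : ℝ) ^ 2) *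
        (2 * (β * (V : ℝ) ^ 2) / klScale klE0 J)) := by
          gcongr
    _ = 2 * (klScale klE0 J' / Real.pi + 3 / 128) * (1793 * klScale klE0 J' + 704) / klScale klE0 J := by
          field_simp
    _ ≤ 8 * (klScale klE0 J' / Real.pi + 3 / 128) * (1793 * klScale klE0 J' + 704) / klScale klE0 J := by
          rw [div_le_div_iff_of_pos_right hΛ]
          have : 0 ≤ (klScale klE0 J' / Real.pi + 3 / 128) * (1793 * klScale klE0 J' + 704) := by positivity
          nlinarith

end Summit.HubbardSuperconductivity.HubbardSuperconductivity.Theorems.TwoVolumeSource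

end
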